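import Summits.NavierStokesRegularity.FluidComputer.BlockEnergyDissipation
import Literature.Analysis.FluidPDE.LerayHopfBoundedWindowRegular
import HarnessLib

/-!
# Fluid computer — L12⁗: the VISCOUS RENT of a level (feeding ≥ gain + dissipation of the block)

HONEST FRAMING (cell `pub-fluidc`, verbatim): *low prior, high value-of-information experiment on Tao's
machine paradigm; NOT a claim that NS blows up.* Theorem side of the cell (necessities every cascade design must
respect); nothing here is evidence of blow-up.

`BlockEnergyTransport.blockL2_sq_le_add_transfer` (input of the transfer floor L12) read Cheskidov–Shvydkoy's block
balance along a maximal smooth finite-energy solution with the viscous term dropped. With the local step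
`BlockEnergyDissipation.piece_blockEnergy_visc` the viscous term is kept:

* `blockL2_sq_add_dissipation_le` (**L12⁗ — GAIN + DISSIPATION ≤ FEEDING**) — for every maximal smooth solution
  `(u, p)` on `ℝ³ × [0, T)` (`ν > 0`), Leray–Hopf from `u 0`, all `0 < s ≤ t < T` and every level `j`:
  `‖Δ̇_j u(t)‖₂² + 2ν ∫⁻_{(s,t]} ∑_i ‖∂_i Δ̇_j u(τ)‖₂² dτ ≤ ‖Δ̇_j u(s)‖₂² + 2 ∫⁻_{(s,t]} (−N_j(u(τ)))⁺ dτ`,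
  `N_j(w) = ∫ ⟪Δ̇_j w, Δ̇_j((w·∇)w)⟫` — what a block holds at time `t` PLUS what viscosity burned in it since `s` is paid
  for by what it held at `s` and by the nonlinear feeding (covering as in `BlockEnergyTransport`).
* `four_pow_mul_blockL2_sq_le` — reverse Bernstein in energy form: `4^j ‖Δ̇_j w‖₂² ≤ 3 C_r² ∑_i ‖∂_i Δ̇_j w‖₂²` for
  smooth `L²` fields (`C_r` the tree's reverse-Bernstein constant, `LPBounds.two_zpow_mul_blockL2_le`, finite
  Cauchy–Schwarz `ennreal_sq_sum_le_card_mul_sum_sq`).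
* `feeding_ge_rent` (**THE VISCOUS RENT**) — hence, multiplied through by `3 C_r²`:
  `3C_r² ‖Δ̇_j u(t)‖₂² + 2ν 4^j ∫⁻_{(s,t]} ‖Δ̇_j u(τ)‖₂² dτ ≤ 3C_r² ‖Δ̇_j u(s)‖₂² + 6C_r² ∫⁻_{(s,t]} (−N_j(u(τ)))⁺ dτ`:
  HOLDING a level at energy `E_j` for a time `ρ` costs nonlinear feeding at least `(ν k_j²/(3C_r²)) E_j ρ`
  (`k_j = 2^j`) on top of any gain — in cascade words the RENT of a level is its viscous rate times its energy, per
  unit time, and a level the relay keeps saturated (the occupation floors of `OccupationFloorsHold`) is fed continuously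
  at that rate, through the two local channels of L12′ (`LevelTransferFloor.transfer_floor_local`) and no others.

0 sorry; no new definitions, no named facts (inputs: `BlockEnergyDissipation.piece_blockEnergy_visc`,
`BlockEnergyTransport.isSmoothL2Field_slice_of_maximal`, `IsMaximalSmoothSolution.isH1RegularOn_Ioo`,
`leray_local_regular_H1_holds`, `LPBounds.two_zpow_mul_blockL2_le`).

## References

* A. Cheskidov, R. Shvydkoy, Arch. Ration. Mech. Anal. 195 (2010) 159–169 = arXiv:0708.3067, Lemma 3.2 (proof, (8)):
  `(1/2) d/dt ‖u_q‖₂² + ν λ_q² ‖u_q‖₂² ≲ ∫ tr[(u⊗u)_q · ∇u_q]`. [CheskidovShvydkoy2010]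
* H. Bahouri, J.-Y. Chemin, R. Danchin, *Fourier Analysis and Nonlinear PDE*, Springer 2011, Lemma 2.1 (Bernstein).
  [BahouriCheminDanchin2011]
-/

noncomputable section

open MeasureTheory Set Function Filter Topology
open scoped ENNReal NNReal RealInnerProductSpace
open Literature.Analysis.FluidPDE Literature.Analysis.FunctionSpaces
open Literature.Analysis.FluidPDE.LPBounds (gradSq)
open Summit.NavierStokesRegularity.FluidComputer.BlockEnergyTransport
open Summit.NavierStokesRegularity.FluidComputer.BlockEnergyDissipation

namespace Summit.NavierStokesRegularity.FluidComputer.BlockViscousRent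

/-! ## Gain + dissipation ≤ feeding along a maximal smooth solution -/

/-- **L12⁗ — GAIN + DISSIPATION ≤ FEEDING.** For every maximal smooth solution `(u, p)` of the unforced Navier–Stokes
system on `ℝ³ × [0, T)` (`ν > 0`) which is Leray–Hopf from `u 0`, all `0 < s ≤ t < T` and every level `j ∈ ℤ`:
`‖Δ̇_j u(t)‖₂² + 2ν ∫⁻_{(s,t]} ∑_i ‖∂_i Δ̇_j u(τ)‖₂² dτ ≤ ‖Δ̇_j u(s)‖₂² + 2 ∫⁻_{(s,t]} (−N_j(u(τ)))⁺ dτ`,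
`N_j(w) = ∫ ⟪Δ̇_j w, Δ̇_j((w·∇)w)⟫`: what a block holds at time `t` plus what viscosity burned in it since `s` is paid by
what it held at `s` and by the nonlinear feeding — Cheskidov–Shvydkoy's (8) `(1/2) d/dt ‖u_q‖₂² + ν‖∇u_q‖₂² = −N_q`
along the maximal solution, integrated, with the transfer kept as the lower integral of its positive part. Proof: the
local step `piece_blockEnergy_visc` covered over `[s, t]` exactly as in `BlockEnergyTransport.blockL2_sq_le_add_transfer`
(uniform Leray lifespan from the `H¹` bound on `[s/2, t]`, dense good times, additivity of the lower integrals).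
[cite: CheskidovShvydkoy2010, Lemma 3.2 (proof, (8))] -/
theorem blockL2_sq_add_dissipation_le {ν T : ℝ} (hν : 0 < ν) (hT : 0 < T)
    {u : ℝ → EuclideanSpace ℝ (Fin 3) → EuclideanSpace ℝ (Fin 3)} {p : ℝ → EuclideanSpace ℝ (Fin 3) → ℝ}
    (hmax : IsMaximalSmoothSolution ν 0 u p T) (hLH : IsLerayHopfOn T ν 0 (u 0) u)
    {s t : ℝ} (hs : 0 < s) (hst : s ≤ t) (htT : t < T) (j : ℤ) :
    blockL2 (u t) j ^ 2 + 2 * ENNReal.ofReal ν * ∫⁻ τ in Ioc s t, gradSq (blockFn j (u τ)) ≤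
      blockL2 (u s) j ^ 2 + 2 * ∫⁻ τ in Ioc s t, ENNReal.ofReal
        (-(∫ x, ⟪blockFn j (u τ) x, blockFn j (convect (u τ) (u τ)) x⟫)) := by
  set F : ℝ → ℝ≥0∞ := fun τ => ENNReal.ofReal
    (-(∫ x, ⟪blockFn j (u τ) x, blockFn j (convect (u τ) (u τ)) x⟫)) with hF
  set V : ℝ → ℝ≥0∞ := fun τ => gradSq (blockFn j (u τ)) with hV
  obtain ⟨c₀, hc₀, hreg⟩ := leray_local_regular_H1_holds
  have hH1 : IsH1RegularOn (Ioo 0 T) u := hmax.isH1RegularOn_Ioo hν hT hLH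
  obtain ⟨M, hM, hMK⟩ := hH1.exists_forall_le (isCompact_Icc : IsCompact (Icc (s / 2) t))
    fun τ hτ => ⟨by linarith [hτ.1], hτ.2.trans_lt htT⟩
  set A : ℝ := M.toReal with hA
  set δ : ℝ := min (c₀ * ν ^ 3 / (A ^ 2 + 1)) (s / 2) with hδ
  have hδpos : 0 < δ := lt_min (div_pos (by positivity) (by positivity)) (by linarith)
  have hδs : δ ≤ s / 2 := min_le_right _ _
  have hAδ : A ^ 2 * δ ≤ c₀ * ν ^ 3 := by
    calc A ^ 2 * δ ≤ A ^ 2 * (c₀ * ν ^ 3 / (A ^ 2 + 1)) := by gcongr; exact min_le_left _ _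
      _ = c₀ * ν ^ 3 * (A ^ 2 / (A ^ 2 + 1)) := by ring
      _ ≤ c₀ * ν ^ 3 * 1 := by gcongr; rw [div_le_one (by positivity)]; linarith
      _ = c₀ * ν ^ 3 := mul_one _
  -- one piece of length `≤ δ/2`
  have single : ∀ s' t' : ℝ, s ≤ s' → s' ≤ t' → t' ≤ t → t' - s' ≤ δ / 2 →
      blockL2 (u t') j ^ 2 + 2 * ENNReal.ofReal ν * ∫⁻ τ in Ioc s' t', V τ ≤
        blockL2 (u s') j ^ 2 + 2 * ∫⁻ τ in Ioc s' t', F τ := by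
    intro s' t' h1 h2 h3 h4
    obtain ⟨σ, hσ, hLHσ⟩ := hLH.exists_isLerayHopfOn_restart_Ioo hν.le (a := s' - δ / 2) (b := s')
      (by linarith) (by linarith) (by linarith)
    have hσT : σ ∈ Ioo 0 T := ⟨by linarith [hσ.1], by linarith [hσ.2]⟩
    have hAσ : eWeakGradL2Sq (u σ) ≤ ENNReal.ofReal A := by
      rw [hA, ENNReal.ofReal_toReal hM.ne]
      exact (le_add_self).trans ((eH1NormSq_def (u σ)).symm.le.trans
        (hMK σ ⟨by linarith [hσ.1], by linarith [hσ.2]⟩))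
    set d : ℝ := min δ (T - σ) with hd
    have hdpos : 0 < d := lt_min hδpos (sub_pos.2 hσT.2)
    have hσd : σ + d ≤ T := by linarith [min_le_right δ (T - σ)]
    have hAd : A ^ 2 * d ≤ c₀ * ν ^ 3 := (mul_le_mul_of_nonneg_left (min_le_left _ _) (sq_nonneg A)).trans hAδ
    have hpiece := piece_blockEnergy_visc hν hmax.1 hLH hreg hσT hLHσ ENNReal.toReal_nonneg hAσ hdpos hσd hAd
    refine hpiece s' t' hσ.2 h2 ?_ (h3.trans_lt htT) j
    have : t' - σ ≤ d := le_min (by linarith [hσ.1]) (by linarith)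
    linarith
  -- chaining
  have cover : ∀ n : ℕ, ∀ s' t' : ℝ, s ≤ s' → s' ≤ t' → t' ≤ t → t' - s' ≤ n * (δ / 2) →
      blockL2 (u t') j ^ 2 + 2 * ENNReal.ofReal ν * ∫⁻ τ in Ioc s' t', V τ ≤
        blockL2 (u s') j ^ 2 + 2 * ∫⁻ τ in Ioc s' t', F τ := by
    intro n
    induction n with
    | zero =>
      intro s' t' h1 h2 h3 h4
      have h5 : t' = s' := by simp only [Nat.cast_zero, zero_mul] at h4; linarith
      subst h5
      simp only [Ioc_self, Measure.restrict_empty, lintegral_zero_measure, mul_zero, add_zero, le_refl]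
    | succ n ih =>
      intro s' t' h1 h2 h3 h4
      by_cases hshort : t' - s' ≤ δ / 2
      · exact single s' t' h1 h2 h3 hshort
      push Not at hshort
      set m : ℝ := s' + δ / 2 with hm
      have hsm := single s' m h1 (by linarith) (by linarith) (by simp [hm])
      have hmt := ih m t' (by linarith) (by linarith) h3 (by push_cast at h4 ⊢; linarith)
      have hdisj : Disjoint (Ioc s' m) (Ioc m t') :=
        Set.disjoint_left.2 fun x hx hx' => lt_irrefl x (hx.2.trans_lt hx'.1)
      have hsplitV : ∫⁻ τ in Ioc s' t', V τ = (∫⁻ τ in Ioc s' m, V τ) + ∫⁻ τ in Ioc m t', V τ := by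
        rw [← lintegral_union measurableSet_Ioc hdisj, Ioc_union_Ioc_eq_Ioc (by linarith) (by linarith)]
      have hsplitF : ∫⁻ τ in Ioc s' t', F τ = (∫⁻ τ in Ioc s' m, F τ) + ∫⁻ τ in Ioc m t', F τ := by
        rw [← lintegral_union measurableSet_Ioc hdisj, Ioc_union_Ioc_eq_Ioc (by linarith) (by linarith)]
      calc blockL2 (u t') j ^ 2 + 2 * ENNReal.ofReal ν * ∫⁻ τ in Ioc s' t', V τ
          = (blockL2 (u t') j ^ 2 + 2 * ENNReal.ofReal ν * ∫⁻ τ in Ioc m t', V τ) +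
              2 * ENNReal.ofReal ν * ∫⁻ τ in Ioc s' m, V τ := by rw [hsplitV]; ring
        _ ≤ (blockL2 (u m) j ^ 2 + 2 * ∫⁻ τ in Ioc m t', F τ) +
              2 * ENNReal.ofReal ν * ∫⁻ τ in Ioc s' m, V τ := by gcongr
        _ = (blockL2 (u m) j ^ 2 + 2 * ENNReal.ofReal ν * ∫⁻ τ in Ioc s' m, V τ) +
              2 * ∫⁻ τ in Ioc m t', F τ := by ring
        _ ≤ (blockL2 (u s') j ^ 2 + 2 * ∫⁻ τ in Ioc s' m, F τ) + 2 * ∫⁻ τ in Ioc m t', F τ := by gcongr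
        _ = blockL2 (u s') j ^ 2 + 2 * ∫⁻ τ in Ioc s' t', F τ := by rw [hsplitF]; ring
  obtain ⟨n, hn⟩ := exists_nat_ge ((t - s) / (δ / 2))
  refine cover n s t le_rfl hst le_rfl ?_
  have hδ2 : 0 < δ / 2 := by linarith
  rwa [div_le_iff₀ hδ2] at hn

/-! ## The viscous rent in amplitude currency -/

/-- **Reverse Bernstein in energy form**: `4^j ‖Δ̇_j w‖₂² ≤ 3 C_r² ∑_i ‖∂_i Δ̇_j w‖₂²` for a smooth `L²` field `w` on
`ℝ³`, `C_r` the reverse-Bernstein constant of the tree's Littlewood–Paley toolbox (`lpBounds (Fin 3)`,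
`LPBounds.two_zpow_mul_blockL2_le`: `2^j ‖Δ̇_j w‖₂ ≤ C_r ∑_i ‖∂_i Δ̇_j w‖₂`) and finite Cauchy–Schwarz.
[cite: BahouriCheminDanchin2011, Lemma 2.1] -/
theorem four_pow_mul_blockL2_sq_le {w : EuclideanSpace ℝ (Fin 3) → EuclideanSpace ℝ (Fin 3)}
    (hw : IsSmoothL2Field w) (j : ℤ) :
    (2 : ℝ≥0∞) ^ (2 * j) * blockL2 w j ^ 2 ≤
      3 * ((lpBounds (Fin 3)).Cr : ℝ≥0∞) ^ 2 * gradSq (blockFn j w) := by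
  set K := lpBounds (Fin 3) with hK
  have h1 := K.two_zpow_mul_blockL2_le hw j
  have h2 : ((2 : ℝ≥0∞) ^ j * blockL2 w j) ^ 2 ≤ ((K.Cr : ℝ≥0∞) * blockGrad w j) ^ 2 := by gcongr
  have h3 : blockGrad w j ^ 2 ≤ 3 * gradSq (blockFn j w) := by
    have h := ennreal_sq_sum_le_card_mul_sum_sq
      (Finset.univ : Finset (Fin (Module.finrank ℝ (EuclideanSpace ℝ (Fin 3)))))
      (fun i => eLpNorm (fun x => fderiv ℝ (blockFn j w) x
        (stdOrthonormalBasis ℝ (EuclideanSpace ℝ (Fin 3)) i)) 2 volume)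
    have hcard : ((Finset.univ : Finset (Fin (Module.finrank ℝ (EuclideanSpace ℝ (Fin 3))))).card : ℝ≥0∞) = 3 := by
      rw [Finset.card_univ, Fintype.card_fin, finrank_euclideanSpace_fin]; norm_num
    rw [hcard] at h
    simpa only [blockGrad, gradSq] using h
  calc (2 : ℝ≥0∞) ^ (2 * j) * blockL2 w j ^ 2 = ((2 : ℝ≥0∞) ^ j * blockL2 w j) ^ 2 := by
        rw [two_mul, ENNReal.zpow_add two_ne_zero ENNReal.ofNat_ne_top]; ring
    _ ≤ ((K.Cr : ℝ≥0∞) * blockGrad w j) ^ 2 := h2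
    _ = (K.Cr : ℝ≥0∞) ^ 2 * blockGrad w j ^ 2 := mul_pow _ _ _
    _ ≤ (K.Cr : ℝ≥0∞) ^ 2 * (3 * gradSq (blockFn j w)) := by gcongr
    _ = 3 * (K.Cr : ℝ≥0∞) ^ 2 * gradSq (blockFn j w) := by ring

/-- **THE VISCOUS RENT.** For every maximal smooth solution `(u, p)` of the unforced Navier–Stokes system on
`ℝ³ × [0, T)` (`ν > 0`), Leray–Hopf from `u 0`, all `0 < s ≤ t < T` and every level `j ∈ ℤ`:
`3 C_r² ‖Δ̇_j u(t)‖₂² + 2ν · 4^j ∫⁻_{(s,t]} ‖Δ̇_j u(τ)‖₂² dτ ≤ 3 C_r² ‖Δ̇_j u(s)‖₂² + 6 C_r² ∫⁻_{(s,t]} (−N_j(u(τ)))⁺ dτ`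
(`C_r` the reverse-Bernstein constant; `blockL2_sq_add_dissipation_le` with `four_pow_mul_blockL2_sq_le` slice by slice,
the slices being smooth `L²` fields by `BlockEnergyTransport.isSmoothL2Field_slice_of_maximal`). Cascade reading, in the
cell's words (level `k_j = 2^j`, level energy `E_j(τ) = ‖Δ̇_j u(τ)‖₂²`): keeping a level at energy `E_j` during a time `ρ`
costs nonlinear feeding at least `(ν k_j² / (3 C_r²)) E_j ρ` on top of any gain — the RENT of a level is its viscous rate
times its energy; the relay's saturated levels (occupation floors, `OccupationFloorsHold`) are therefore fed continuously
at that rate, and by L12′ only through the two local channels. Necessity only. [cite: CheskidovShvydkoy2010, Lemma 3.2 (proof, (8))] -/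
theorem feeding_ge_rent {ν T : ℝ} (hν : 0 < ν) (hT : 0 < T)
    {u : ℝ → EuclideanSpace ℝ (Fin 3) → EuclideanSpace ℝ (Fin 3)} {p : ℝ → EuclideanSpace ℝ (Fin 3) → ℝ}
    (hmax : IsMaximalSmoothSolution ν 0 u p T) (hLH : IsLerayHopfOn T ν 0 (u 0) u)
    {s t : ℝ} (hs : 0 < s) (hst : s ≤ t) (htT : t < T) (j : ℤ) :
    3 * ((lpBounds (Fin 3)).Cr : ℝ≥0∞) ^ 2 * blockL2 (u t) j ^ 2 +
        2 * ENNReal.ofReal ν * (2 : ℝ≥0∞) ^ (2 * j) * ∫⁻ τ in Ioc s t, blockL2 (u τ) j ^ 2 ≤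
      3 * ((lpBounds (Fin 3)).Cr : ℝ≥0∞) ^ 2 * blockL2 (u s) j ^ 2 +
        3 * ((lpBounds (Fin 3)).Cr : ℝ≥0∞) ^ 2 * (2 * ∫⁻ τ in Ioc s t, ENNReal.ofReal
          (-(∫ x, ⟪blockFn j (u τ) x, blockFn j (convect (u τ) (u τ)) x⟫))) := by
  set R : ℝ≥0∞ := 3 * ((lpBounds (Fin 3)).Cr : ℝ≥0∞) ^ 2 with hR
  have h := blockL2_sq_add_dissipation_le hν hT hmax hLH hs hst htT j
  -- slice by slice: `4^j a_j(τ)² ≤ R · gradSq (Δ̇_j u(τ))`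
  have hRtop : R ≠ ∞ := ENNReal.mul_ne_top (by norm_num) (ENNReal.pow_ne_top ENNReal.coe_ne_top)
  have hV : (2 : ℝ≥0∞) ^ (2 * j) * ∫⁻ τ in Ioc s t, blockL2 (u τ) j ^ 2 ≤
      R * ∫⁻ τ in Ioc s t, gradSq (blockFn j (u τ)) := by
    rw [← lintegral_const_mul' _ _ (two_zpow_ne_top _), ← lintegral_const_mul' _ _ hRtop]
    refine setLIntegral_mono' measurableSet_Ioc fun τ hτ => ?_
    have hw : IsSmoothL2Field (u τ) :=
      isSmoothL2Field_slice_of_maximal hν hT hmax hLH ⟨hs.trans hτ.1, hτ.2.trans_lt htT⟩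
    simpa only [hR] using four_pow_mul_blockL2_sq_le hw j
  calc R * blockL2 (u t) j ^ 2 + 2 * ENNReal.ofReal ν * (2 : ℝ≥0∞) ^ (2 * j) * ∫⁻ τ in Ioc s t, blockL2 (u τ) j ^ 2
      = R * blockL2 (u t) j ^ 2 + 2 * ENNReal.ofReal ν * ((2 : ℝ≥0∞) ^ (2 * j) * ∫⁻ τ in Ioc s t, blockL2 (u τ) j ^ 2) := by
        ring
    _ ≤ R * blockL2 (u t) j ^ 2 + 2 * ENNReal.ofReal ν * (R * ∫⁻ τ in Ioc s t, gradSq (blockFn j (u τ))) := by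
        gcongr
    _ = R * (blockL2 (u t) j ^ 2 + 2 * ENNReal.ofReal ν * ∫⁻ τ in Ioc s t, gradSq (blockFn j (u τ))) := by ring
    _ ≤ R * (blockL2 (u s) j ^ 2 + 2 * ∫⁻ τ in Ioc s t, ENNReal.ofReal
          (-(∫ x, ⟪blockFn j (u τ) x, blockFn j (convect (u τ) (u τ)) x⟫))) := by gcongr
    _ = R * blockL2 (u s) j ^ 2 + R * (2 * ∫⁻ τ in Ioc s t, ENNReal.ofReal
          (-(∫ x, ⟪blockFn j (u τ) x, blockFn j (convect (u τ) (u τ)) x⟫))) := mul_add _ _ _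

end Summit.NavierStokesRegularity.FluidComputer.BlockViscousRent

end
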